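import Literature.Geometry.Lorentzian.KerrSchildCoord
import Literature.Geometry.Lorentzian.KerrCylinderParameterCloseness
import Summits.FinalStateConjecture.FinalStateConjecture.Theorems.BartnikGapSettlingGapExhaustionKerrBilinCoerciveExterior
import Summits.FinalStateConjecture.FinalStateConjecture.Theorems.BartnikGapSettlingGapExhaustionKerrBandHigherRegularityUniform
import HarnessLib

/-!
# `KerrBilinCoerciveUniform`: coercivity of the Kerr–Schild forms on the exteriors `{r ≥ r_lo(ℓ)}`,
# UNIFORMLY over a compact set of labels `ℓ = (M, a)`
(crux `GapExhaustion`, stmt-FinalStateConjecture-10808, line photon-shell-pseudoconvexity;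
stub (UC) `stub_kerrBilin_coercive_exteriorU`, the label-uniform twin of the per-label brick
`stub_kerrBilin_coercive_exterior` of `BartnikGapSettlingGapExhaustionKerrBilinCoerciveExterior.lean`;
lead c11, label-uniformity wave 1)

The registered outward Killing sweep S5 quantifies its constants BEFORE the Kerr label `(M, a)`,
over a compact window of labels. The per-label coercivity constant of the Kerr–Schild form
`g_{M,a}` on the exterior `{r ≥ r_lo}` (all times) therefore has to be ONE constant for all labels
`ℓ = (M, a)` of a compact set `K ⊆ {0 ≤ M}` and all exteriors `{r ≥ r_lo(ℓ)}`, `r_lo > 0`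
continuous on `K`: there is `β > 0` with `β‖v‖ ≤ ‖g_{M,a}(z)(v, ·)‖` for every `ℓ = (M, a) ∈ K`,
every `z` with `r_a(z) ≥ r_lo(ℓ)` and every `v`.

Proof: `r_lo` has a positive lower bound `r₀` on `K` and the masses are bounded, `M ≤ B` on `K`
(compactness). Split at `R₀ = 4B + 1`:

* **far** (`r ≥ R₀ ≥ 4M`): the label-free far estimate `kerrCoercive_far` (`β = 1/2`);
* **band** (`r₀ ≤ r ≤ R₀`): the continuous positive function `((ℓ, x), u) ↦ ‖g_ℓ(x) u‖` on the
  compact set `S × {‖u‖ = 1}`, `S = {(ℓ, x) | ℓ ∈ K, x⁰ = 0, r₀ ≤ r_{ℓ.2}(x) ≤ R₀}` the compact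
  LABELLED time slice (closed since `K` is closed and the Kerr–Schild radius is jointly continuous
  in `(a, x)`; bounded by `‖x⃗‖² ≤ r² + a²`), has a positive minimum `β₁` — continuity is the joint
  smoothness of the Kerr–Schild family `(M, a, x) ↦ g_{M,a}(x)` on `{r > 0}`
  (`Kerr.contDiffAt_bilin₃`), positivity is nondegeneracy of `g_{M,a}` wherever `r > 0`
  (`Kerr.bilin_nondegenerate`); the bound is transported to all times by stationarity
  (`Kerr.bilin_add_smul_basisVector_zero`, `Kerr.radius_add_time_smul_basisVector`) and to all `v`
  by homogeneity (`injClose_coercive_of_sphere`);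

and `β := min (1/2) β₁`.

References: R. P. Kerr, A. Schild (1965), §§2–3 [KerrSchild1965]; M. Visser, arXiv:0706.0622,
(32)–(35) [arXiv07060622].
-/

noncomputable section

-- instance search through the nested operator types `E4 →L[ℝ] E4 →L[ℝ] ℝ`
set_option maxSynthPendingDepth 3

-- D-0017: single-problem summit, `Summit.<S>.<S>.…` by design (cf. lakefile `weak.linter.dupNamespace`).
set_option linter.dupNamespace false

namespace Summit.FinalStateConjecture.FinalStateConjecture.Theorems

open Set Literature.Geometry.Lorentzian
open scoped Manifold ContDiff Topology

/-- The labelled time slice `{(ℓ, x) | ℓ ∈ K, x⁰ = 0, r₀ ≤ r_{ℓ.2}(x) ≤ R₀}` of the bands over a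
compact set `K` of labels is compact: closed (the Kerr–Schild radius is jointly continuous in
`(a, x)`, `stub_kerrBandHigherRegularityU_continuous_radius`) and bounded (`‖x⃗‖² ≤ r² + a²`,
`stub_kerrBandHigherRegularityU_norm_sq_le`; Visser arXiv:0706.0622, (35)).
[cite: KerrSchild1965, §3] -/
theorem stub_kerrBilin_coercive_exteriorU_isCompact_slice {K : Set (ℝ × ℝ)} (hK : IsCompact K)
    (r₀ R₀ : ℝ) :
    IsCompact {q : (ℝ × ℝ) × E4 | q.1 ∈ K ∧ q.2 0 = 0 ∧ r₀ ≤ Kerr.radius q.1.2 q.2 ∧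
      Kerr.radius q.1.2 q.2 ≤ R₀} := by
  have hradc : Continuous fun q : (ℝ × ℝ) × E4 ↦ Kerr.radius q.1.2 q.2 :=
    stub_kerrBandHigherRegularityU_continuous_radius
  have hclosed : IsClosed {q : (ℝ × ℝ) × E4 | q.1 ∈ K ∧ q.2 0 = 0 ∧
      r₀ ≤ Kerr.radius q.1.2 q.2 ∧ Kerr.radius q.1.2 q.2 ≤ R₀} := by
    simp only [setOf_and]
    exact (hK.isClosed.preimage continuous_fst).inter
      ((isClosed_eq ((E4.dx 0).continuous.comp continuous_snd) continuous_const).inter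
        ((isClosed_le continuous_const hradc).inter (isClosed_le hradc continuous_const)))
  obtain ⟨B, hB⟩ := hK.isBounded.exists_norm_le
  refine (hK.prod (isCompact_closedBall (0 : E4) (|R₀| + |B|))).of_isClosed_subset hclosed ?_
  intro q hq
  obtain ⟨hℓ, hx0, -, hxhi⟩ := hq
  refine mk_mem_prod hℓ (mem_closedBall_zero_iff.2 ?_)
  have h1 := stub_kerrBandHigherRegularityU_norm_sq_le (a := q.1.2) hx0
  have h2 : Kerr.radius q.1.2 q.2 ≤ |R₀| := hxhi.trans (le_abs_self _)
  have h3 : |q.1.2| ≤ |B| :=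
    ((Real.norm_eq_abs _).symm.le.trans (norm_snd_le q.1)).trans
      ((hB q.1 hℓ).trans (le_abs_self _))
  have h4 : Kerr.radius q.1.2 q.2 ^ 2 ≤ |R₀| ^ 2 :=
    pow_le_pow_left₀ (Kerr.radius_nonneg _ _) h2 2
  have h5 : q.1.2 ^ 2 ≤ |B| ^ 2 := by
    rw [← sq_abs q.1.2]
    exact pow_le_pow_left₀ (abs_nonneg _) h3 2
  have h6 : ‖q.2‖ ^ 2 ≤ (|R₀| + |B|) ^ 2 := by nlinarith [abs_nonneg R₀, abs_nonneg B]
  exact (sq_le_sq₀ (norm_nonneg _) (by positivity)).1 h6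

/-- **Coercivity of the Kerr–Schild forms on the compact labelled time slice
`{(ℓ, x) | ℓ ∈ K, x⁰ = 0, r₀ ≤ r_{ℓ.2}(x) ≤ R₀}`, `r₀ > 0`, uniformly in the label**: the function
`((ℓ, x), u) ↦ ‖g_ℓ(x) u‖` is continuous (joint smoothness of the Kerr–Schild family
`(M, a, x) ↦ g_{M,a}(x)` on `{r > 0}`, Kerr–Schild 1965, §3) and positive (nondegeneracy of
`g_{M,a}` wherever `r > 0`, Kerr–Schild 1965, §2) on the compact set `slice × unit sphere`, hence
bounded below by a positive constant. [cite: KerrSchild1965, §3] -/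
theorem stub_kerrBilin_coercive_exteriorU_slice {K : Set (ℝ × ℝ)} (hK : IsCompact K) {r₀ : ℝ}
    (R₀ : ℝ) (hr₀ : 0 < r₀) :
    ∃ β : ℝ, 0 < β ∧ ∀ q ∈ {q : (ℝ × ℝ) × E4 | q.1 ∈ K ∧ q.2 0 = 0 ∧
        r₀ ≤ Kerr.radius q.1.2 q.2 ∧ Kerr.radius q.1.2 q.2 ≤ R₀},
      ∀ v : E4, β * ‖v‖ ≤ ‖Kerr.bilin q.1.1 q.1.2 q.2 v‖ := by
  set S : Set ((ℝ × ℝ) × E4) := {q | q.1 ∈ K ∧ q.2 0 = 0 ∧ r₀ ≤ Kerr.radius q.1.2 q.2 ∧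
    Kerr.radius q.1.2 q.2 ≤ R₀} with hSdef
  have hS : IsCompact S := stub_kerrBilin_coercive_exteriorU_isCompact_slice hK r₀ R₀
  have hSpos : ∀ q ∈ S, 0 < Kerr.radius q.1.2 q.2 := fun q hq ↦ hr₀.trans_le hq.2.2.1
  have hK' : IsCompact (S ×ˢ Metric.sphere (0 : E4) 1) := hS.prod (isCompact_sphere 0 1)
  -- joint continuity of the Kerr–Schild family in `(ℓ, x)` on `{r > 0}`
  have hF : ∀ q ∈ S, ContinuousAt (fun q : (ℝ × ℝ) × E4 ↦ Kerr.bilin q.1.1 q.1.2 q.2) q :=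
    fun q hq ↦ by
    have h := (Kerr.contDiffAt_bilin₃ (n := 0) (q := (q.1.1, q.1.2, q.2)) (hSpos q hq)).comp q
      (contDiffAt_fst.fst.prodMk (contDiffAt_fst.snd.prodMk contDiffAt_snd))
    exact h.continuousAt
  have hcont : ContinuousOn
      (fun p : ((ℝ × ℝ) × E4) × E4 ↦ ‖Kerr.bilin p.1.1.1 p.1.1.2 p.1.2 p.2‖)
      (S ×ˢ Metric.sphere (0 : E4) 1) := by
    refine ContinuousOn.norm (ContinuousOn.clm_apply ?_ continuous_snd.continuousOn)
    intro p hp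
    exact ((hF p.1 hp.1).comp continuousAt_fst).continuousWithinAt
  have hpos : ∀ p ∈ S ×ˢ Metric.sphere (0 : E4) 1,
      (0 : ℝ) < ‖Kerr.bilin p.1.1.1 p.1.1.2 p.1.2 p.2‖ := by
    intro p hp
    rw [norm_pos_iff]
    intro h0
    have hv : p.2 = 0 :=
      Kerr.bilin_nondegenerate p.1.1.1 p.1.1.2 (hSpos p.1 hp.1) p.2 fun w ↦ by rw [h0]; rfl
    have h1 : ‖p.2‖ = 1 := mem_sphere_zero_iff_norm.mp hp.2
    rw [hv, norm_zero] at h1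
    exact zero_ne_one h1
  obtain ⟨β, hβ, hle⟩ := hK'.exists_forall_le' hcont hpos
  refine ⟨β, hβ, fun q hq ↦
    injClose_coercive_of_sphere (Kerr.bilin q.1.1 q.1.2 q.2) fun u hu ↦ ?_⟩
  exact hle (q, u) ⟨hq, hu⟩

/-- **Coercivity of the Kerr–Schild forms on the bands `r₀ ≤ r ≤ R₀` (all times), uniformly over
a compact set `K` of labels**: a band point `z` at time `t = z⁰` is translated to the compact
labelled time slice `{x⁰ = 0}` (`z = z' + t ∂₀`), where `stub_kerrBilin_coercive_exteriorU_slice`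
applies, and Kerr–Schild is stationary (`g_{x + t∂₀} = g_x`, `r(x + t∂₀) = r(x)`; Kerr–Schild 1965,
§2). [cite: KerrSchild1965, §2] -/
theorem stub_kerrBilin_coercive_exteriorU_band {K : Set (ℝ × ℝ)} (hK : IsCompact K) {r₀ : ℝ}
    (R₀ : ℝ) (hr₀ : 0 < r₀) :
    ∃ β : ℝ, 0 < β ∧ ∀ ℓ ∈ K, ∀ z : E4, r₀ ≤ Kerr.radius ℓ.2 z → Kerr.radius ℓ.2 z ≤ R₀ →
      ∀ v : E4, β * ‖v‖ ≤ ‖Kerr.bilin ℓ.1 ℓ.2 z v‖ := by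
  obtain ⟨β, hβ, hS⟩ := stub_kerrBilin_coercive_exteriorU_slice hK R₀ hr₀
  refine ⟨β, hβ, fun ℓ hℓ z hzlo hzhi v ↦ ?_⟩
  -- translate `z` to the time slice: `z = z' + t ∂₀`, `t = z⁰`
  obtain ⟨t, ht⟩ : ∃ t : ℝ, z 0 = t := ⟨_, rfl⟩
  obtain ⟨z', hz'z⟩ : ∃ z' : E4, z' + t • E4.basisVector 0 = z :=
    ⟨z - t • E4.basisVector 0, sub_add_cancel z _⟩
  have hz'0 : z' 0 = 0 := by
    have h : (z' + t • E4.basisVector 0) 0 = z 0 := by rw [hz'z]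
    rw [ht] at h
    simpa [E4.basisVector] using h
  -- stationarity of Kerr: the radius and the components agree
  have hrad' : Kerr.radius ℓ.2 z' = Kerr.radius ℓ.2 z := by
    rw [← hz'z, Kerr.radius_add_time_smul_basisVector]
  have hbil' : Kerr.bilin ℓ.1 ℓ.2 z' = Kerr.bilin ℓ.1 ℓ.2 z := by
    rw [← hz'z, Kerr.bilin_add_smul_basisVector_zero]
  have h : β * ‖v‖ ≤ ‖Kerr.bilin ℓ.1 ℓ.2 z' v‖ :=
    hS (ℓ, z') ⟨hℓ, hz'0, hzlo.trans_eq hrad'.symm, hrad'.trans_le hzhi⟩ v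
  rwa [hbil'] at h

/-- **(UC) Uniform coercivity of the Kerr–Schild forms on the exteriors `{r ≥ r_lo(ℓ)}`, over a
compact set `K ⊆ {0 ≤ M}` of labels `ℓ = (M, a)` with `r_lo > 0` continuous on `K` (crux
`GapExhaustion`, stmt-FinalStateConjecture-10808; line photon-shell-pseudoconvexity, label-uniform
form of (W3-A) `stub_kerrBilin_coercive_exterior`)**: there is `β > 0` with
`β‖v‖ ≤ ‖g_{M,a}(z)(v, ·)‖` for all `(M, a) ∈ K`, all `z` with `r_a(z) ≥ r_lo(M, a)` (all times)
and all `v`. With `r₀ > 0` a lower bound of `r_lo` on `K` and `M ≤ B` on `K` (compactness), split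
at `R₀ = 4B + 1`: beyond `R₀` the label-free far bound `kerrCoercive_far` (`β = 1/2`, from
`0 ≤ 2H ≤ 1/2` for `r ≥ 4M`), on the bands `r₀ ≤ r ≤ R₀` the uniform band coercivity
`stub_kerrBilin_coercive_exteriorU_band` (compact labelled time slice, joint continuity of the
Kerr–Schild family in `(M, a, x)`, nondegeneracy, stationarity; Kerr–Schild 1965, §§2–3).
[cite: KerrSchild1965, §2] -/
theorem stub_kerrBilin_coercive_exteriorU :
    ∀ (K : Set (ℝ × ℝ)) (r_lo : ℝ × ℝ → ℝ), IsCompact K → (∀ ℓ ∈ K, 0 ≤ ℓ.1) →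
      ContinuousOn r_lo K → (∀ ℓ ∈ K, 0 < r_lo ℓ) →
      ∃ β : ℝ, 0 < β ∧ ∀ ℓ ∈ K, ∀ z : E4, r_lo ℓ ≤ Kerr.radius ℓ.2 z →
        ∀ v : E4, β * ‖v‖ ≤ ‖Kerr.bilin ℓ.1 ℓ.2 z v‖ := by
  intro K r_lo hK hKM hloc hlop
  -- a positive lower bound `r₀` of `r_lo` on the compact `K`
  obtain ⟨r₀, hr₀, hr₀le⟩ := hK.exists_forall_le' hloc hlop
  -- a bound `B` on the labels of `K`, whence on the masses: `ℓ.1 ≤ B`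
  obtain ⟨B, hB⟩ := hK.isBounded.exists_norm_le
  have hMB : ∀ ℓ ∈ K, ℓ.1 ≤ B := fun ℓ hℓ ↦
    (le_abs_self _).trans (((Real.norm_eq_abs _).symm.le.trans (norm_fst_le ℓ)).trans (hB ℓ hℓ))
  obtain ⟨β₁, hβ₁, hband⟩ := stub_kerrBilin_coercive_exteriorU_band hK (4 * B + 1) hr₀
  refine ⟨min (1 / 2) β₁, lt_min one_half_pos hβ₁, fun ℓ hℓ z hz v ↦ ?_⟩
  rcases le_total (4 * B + 1) (Kerr.radius ℓ.2 z) with hfar | hnear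
  · have hr : 0 < Kerr.radius ℓ.2 z := (hlop ℓ hℓ).trans_le hz
    have h4 : 4 * ℓ.1 ≤ Kerr.radius ℓ.2 z := by
      have h1 := hMB ℓ hℓ
      linarith
    calc min (1 / 2) β₁ * ‖v‖ ≤ 1 / 2 * ‖v‖ :=
          mul_le_mul_of_nonneg_right (min_le_left _ _) (norm_nonneg _)
      _ ≤ ‖Kerr.bilin ℓ.1 ℓ.2 z v‖ := kerrCoercive_far (hKM ℓ hℓ) ℓ.2 hr h4 v
  · calc min (1 / 2) β₁ * ‖v‖ ≤ β₁ * ‖v‖ :=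
          mul_le_mul_of_nonneg_right (min_le_right _ _) (norm_nonneg _)
      _ ≤ ‖Kerr.bilin ℓ.1 ℓ.2 z v‖ := hband ℓ hℓ z ((hr₀le ℓ hℓ).trans hz) hnear v

end Summit.FinalStateConjecture.FinalStateConjecture.Theorems

end
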